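import Summits.BirchSwinnertonDyer.BirchSwinnertonDyer.Theorems.ManinLocalTwoThreeParabolicHeckePerm
import HarnessLib

/-!
# `(T_r u)(g_x T^w g_x⁻¹) = r · u(g_{ρx} T^w g_{ρx}⁻¹) + u(g_{ρ⁻¹x} T^w g_{ρ⁻¹x}⁻¹)`

Summit `BirchSwinnertonDyer`, route `ManinLocalTwoThree` (cell bsd-f2-manin), cruxes C2 `ManinOddAtFour`
(stmt-BirchSwinnertonDyer-22967) / C3 `ManinPrimeToThreeAtNine` (stmt-BirchSwinnertonDyer-22968).  Fifth file of N4
PARABOLICITY (MEMO-es §22.2 (0), REF1 §R43 N4): the Hecke operator `T_r = heckeU 0 L K hr` of `Hom(Γ₀(L), K)`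
evaluated on the parabolic element `Π_x = g_x T^w g_x⁻¹ ∈ Γ₀(L)` of exponent `w` at the cusp `x` (`r` prime,
`r ∤ L`, `r ∤ w`):

  `(T_r u)(Π_x) = r · parabolicValue w u (ρ_r x) + parabolicValue w u (ρ_r⁻¹ x)`      (`heckeU_parabolicAt`)

— the `σ_Π`-fixed index contributes `u(P T^{rw} P⁻¹) = r·u(P T^w P⁻¹)` (`P∞ = ρ_r x`), and the `r`-cycle `j ↦ j + w` of
the other indices telescopes to `u(G T^w G⁻¹)` (`G∞ = ρ_r⁻¹ x`) (`Theorems/ManinLocalTwoThreeParabolicHeckePerm.lean`).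
Consequently the cusp function `parabolicValue L K w u` of a cocycle `u` is carried by `T_r` on `u` to
`T♯_r = r A_r + B_r` on functions (`parabolicValue_heckeU`), also off the locus where `Π_x ∉ Γ₀(L)` (membership is carried
along `ρ_r^{±1}`).  No new definitions; nothing about BSD or Manin's conjecture is proved here.

References: G. Shimura (1971) §8.3 (8.3.2); cell memo HOME/MEMO-es.md §22.2 (0); cell INBOX 2026-08-28T03:17:26Z (p3 (C)).
-/

set_option autoImplicit false
set_option linter.dupNamespace false

open scoped MatrixGroups

open CongruenceSubgroup Matrix.SpecialLinearGroup Literature.NumberTheory.EllipticCurves.ModularForms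
  Literature.NumberTheory.EllipticCurves.ModularForms.HidaCohomology

namespace Summit.BirchSwinnertonDyer.BirchSwinnertonDyer.Theorems.ManinLocalTwoThree

section HeckeValue

variable (L : ℕ) {K : Type*} [CommRing K] {r : ℕ} [NeZero r] (hr : r.Prime)

/-- **The Hecke operator on the parabolic element at a cusp** (`r` prime, `r ∤ L`, `r ∤ w`, `u` a degree-`0` cocycle,
`Π_x = g_x T^w g_x⁻¹ ∈ Γ₀(L)`): the parabolic elements at `ρ_r x` and `ρ_r⁻¹ x` also lie in `Γ₀(L)`, and
`(T_r u)(Π_x) = r · u(Π_{ρ_r x}) + u(Π_{ρ_r⁻¹ x})`. [cite: Shimura1971, §8.3 (8.3.2)] -/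
theorem heckeU_parabolicAt (hrL : ¬ r ∣ L) (w : ℤ) (hrw : ¬ (r : ℤ) ∣ w) {u : Gamma0 L → Fin 1 → K}
    (hu : u ∈ cocycles 0 L K) (x : OnePoint ℚ) (hx : parabolicAt (cuspMatrix x) w ∈ Gamma0 L) :
    parabolicAt (cuspMatrix (heckeNbrInfty hr x)) w ∈ Gamma0 L ∧
    parabolicAt (cuspMatrix (heckeNbrZero hr x)) w ∈ Gamma0 L ∧
    heckeU 0 L K hr u ⟨parabolicAt (cuspMatrix x) w, hx⟩ 0 =
      (r : K) * parabolicValue L K w u (heckeNbrInfty hr x) + parabolicValue L K w u (heckeNbrZero hr x) := by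
  classical
  haveI : Fact r.Prime := ⟨hr⟩
  set g : SL(2, ℤ) := cuspMatrix x with hg
  set g₁ : Gamma0 1 := cuspMatrix₁ x with hg₁
  set PiL : Gamma0 L := ⟨parabolicAt g w, hx⟩ with hPiL
  -- level-1 permutation data of `g`
  let G : Option (ZMod r) → SL(2, ℤ) := fun o ↦ ((heckePermElt hr g₁ (heckeIdxPre hr g₁ o) : Gamma0 1) : SL(2, ℤ))
  let oOf : Option (ZMod r) → Option (ZMod r) := fun o ↦ (heckeIdxPre hr g₁ o).1
  have hGspec : ∀ o, (G o : Matrix (Fin 2) (Fin 2) ℤ) * heckeRep r o = heckeRep r (oOf o) * (g : Matrix (Fin 2) (Fin 2) ℤ) := by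
    intro o
    have h := heckePermElt_spec hr g₁ (heckeIdxPre hr g₁ o)
    rw [heckePerm_heckeIdxPre] at h
    exact h
  -- the level-`L` indices, enumerated through `τ⁻¹`
  let idx : Option (ZMod r) → HeckeIdx L r := fun o ↦ ⟨oOf o, fun _ ↦ hrL⟩
  let Φ : Option (ZMod r) ≃ HeckeIdx L r :=
    ((Equiv.subtypeUnivEquiv (fun o ↦ heckeIdx_one_cond hr o)).symm.trans (heckePermEquiv hr g₁).symm).trans
      (Equiv.subtypeEquivRight (fun o ↦ ⟨fun _ _ ↦ hrL, fun _ ↦ heckeIdx_one_cond hr o⟩))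
  have hΦ : ∀ o, Φ o = idx o := fun o ↦ rfl
  have hsum : heckeU 0 L K hr u PiL 0 = ∑ o : Option (ZMod r), u (heckePermElt hr PiL (idx o)) 0 := by
    rw [heckeU_apply, Finset.sum_apply]
    simp only [act_zero_eq_id, LinearMap.id_apply]
    exact (Fintype.sum_equiv Φ (fun o ↦ u (heckePermElt hr PiL (idx o)) 0) (fun i ↦ u (heckePermElt hr PiL i) 0)
      (fun o ↦ by rw [hΦ])).symm
  -- the fixed index: value `o₀ = τ⁻¹(∞)`, matrix `P`, `Π' = P T^{rw} P⁻¹`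
  set P : SL(2, ℤ) := G none with hP
  have hPspec : (P : Matrix (Fin 2) (Fin 2) ℤ) * heckeRep r none = heckeRep r (oOf none) * (g : Matrix (Fin 2) (Fin 2) ℤ) :=
    hGspec none
  obtain ⟨-, hE0⟩ := heckePermElt_parabolic_infty hr g w hx P (oOf none) hPspec (idx none) rfl
  have hPx : (mapGL ℚ P : GL (Fin 2) ℚ) • (OnePoint.infty : OnePoint ℚ) = heckeNbrInfty hr x := by
    rw [heckeNbrInfty_def]
  have hcop : IsCoprime (L : ℤ) (r : ℤ) :=
    (Nat.isCoprime_iff_coprime.mpr ((Nat.Prime.coprime_iff_not_dvd hr).mpr hrL)).symm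
  have hmemP : parabolicAt P w ∈ Gamma0 L := by
    have h1 : parabolicAt P ((r : ℤ) * w) ∈ Gamma0 L := hE0 ▸ (heckePermElt hr PiL (idx none)).2
    rw [parabolicAt_mem_Gamma0_iff] at h1 ⊢
    rw [mul_assoc] at h1
    exact hcop.dvd_of_dvd_mul_left h1
  have hval0 : u (heckePermElt hr PiL (idx none)) 0 = (r : K) * parabolicValue L K w u (heckeNbrInfty hr x) := by
    have he : heckePermElt hr PiL (idx none) = (⟨parabolicAt P w, hmemP⟩ : Gamma0 L) ^ r := by
      apply Subtype.ext
      rw [hE0, SubmonoidClass.coe_pow, parabolicAt_pow, mul_comm]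
    rw [he, cocycle_zero_pow hu, Pi.smul_apply, nsmul_eq_mul, parabolicValue_eq_of_smul_infty L w u P _ hPx hmemP]
  -- the cycle: `jⱼ = k·w mod r`, carries `q`
  have hw0 : ((w : ℤ) : ZMod r) ≠ 0 := by
    rw [Ne, ZMod.intCast_zmod_eq_zero_iff_dvd]
    exact hrw
  let jj : ℕ → ZMod r := fun k ↦ (k : ZMod r) * (w : ZMod r)
  have hjj0 : jj 0 = 0 := by simp [jj]
  have hjjs : ∀ k, jj (k + 1) = jj k + (w : ZMod r) := fun k ↦ by simp [jj, Nat.cast_succ, add_mul]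
  have hjjr : jj r = 0 := by simp [jj]
  let q : ZMod r → ℤ := fun j ↦ ((j.val : ℤ) + w - ((j + (w : ZMod r)).val : ℤ)) / r
  have hq : ∀ j : ZMod r, (j.val : ℤ) + w = ((j + (w : ZMod r)).val : ℤ) + q j * r := by
    intro j
    have hdvd : (r : ℤ) ∣ (j.val : ℤ) + w - ((j + (w : ZMod r)).val : ℤ) := by
      rw [← ZMod.intCast_zmod_eq_zero_iff_dvd]
      push_cast
      rw [ZMod.natCast_zmod_val, ZMod.natCast_zmod_val]
      ring
    obtain ⟨m, hm⟩ := hdvd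
    have hqm : q j = m := by
      show ((j.val : ℤ) + w - ((j + (w : ZMod r)).val : ℤ)) / r = m
      rw [hm, Int.mul_ediv_cancel_left _ (by exact_mod_cast hr.ne_zero)]
    rw [hqm]
    linear_combination hm
  have hEj : ∀ j : ZMod r, ((heckePermElt hr PiL (idx (some j)) : Gamma0 L) : SL(2, ℤ)) =
      G (some j) * ModularGroup.T ^ (q j) * (G (some (j + (w : ZMod r))))⁻¹ :=
    fun j ↦ (heckePermElt_parabolic_some hr g w hx (G (some j)) (G (some (j + (w : ZMod r)))) (oOf (some j))
      (oOf (some (j + (w : ZMod r)))) j (j + (w : ZMod r)) (q j) (hq j) (hGspec (some j)) (hGspec (some (j + (w : ZMod r))))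
      (idx (some j)) rfl).2
  -- telescoping along the cycle
  have htel : ∀ n : ℕ, ∃ E : Gamma0 L,
      (E : SL(2, ℤ)) = G (some (jj 0)) * ModularGroup.T ^ (∑ k ∈ Finset.range n, q (jj k)) * (G (some (jj n)))⁻¹ ∧
      u E 0 = ∑ k ∈ Finset.range n, u (heckePermElt hr PiL (idx (some (jj k)))) 0 := by
    intro n
    induction n with
    | zero =>
      refine ⟨1, ?_, ?_⟩
      · rw [Subgroup.coe_one, Finset.sum_range_zero, zpow_zero, mul_one, mul_inv_cancel]
      · rw [cocycle_map_one hu, Pi.zero_apply, Finset.sum_range_zero]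
    | succ n ih =>
      obtain ⟨E, hE, huE⟩ := ih
      refine ⟨E * heckePermElt hr PiL (idx (some (jj n))), ?_, ?_⟩
      · rw [Subgroup.coe_mul, hE, hEj (jj n), ← hjjs n, Finset.sum_range_succ, zpow_add]
        group
      · rw [cocycle_zero_mul hu, Pi.add_apply, huE, Finset.sum_range_succ]
  obtain ⟨E, hE, huE⟩ := htel r
  have hQ : ∑ k ∈ Finset.range r, q (jj k) = w := by
    have h1 : ∀ k, (r : ℤ) * q (jj k) = (((jj k).val : ℤ) - ((jj (k + 1)).val : ℤ)) + w := by
      intro k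
      have h := hq (jj k)
      rw [← hjjs] at h
      linear_combination -h
    have h2 : (r : ℤ) * ∑ k ∈ Finset.range r, q (jj k) = (r : ℤ) * w := by
      rw [Finset.mul_sum]
      simp_rw [h1]
      rw [Finset.sum_add_distrib, Finset.sum_range_sub' (fun k ↦ ((jj k).val : ℤ)), Finset.sum_const, Finset.card_range,
        hjj0, hjjr, sub_self, zero_add, nsmul_eq_mul]
    exact mul_left_cancel₀ (by exact_mod_cast hr.ne_zero : (r : ℤ) ≠ 0) h2
  rw [hQ, hjjr, hjj0] at hE
  set Q0 : SL(2, ℤ) := G (some 0) with hQ0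
  have hQx : (mapGL ℚ Q0 : GL (Fin 2) ℚ) • (OnePoint.infty : OnePoint ℚ) = heckeNbrZero hr x := by
    rw [heckeNbrZero_def]
  have hmemQ : parabolicAt Q0 w ∈ Gamma0 L := by
    rw [parabolicAt_def, ← hE]
    exact E.2
  have hvalQ : u E 0 = parabolicValue L K w u (heckeNbrZero hr x) := by
    rw [parabolicValue_eq_of_smul_infty L w u Q0 _ hQx hmemQ]
    congr 1
    apply Subtype.ext
    show (E : SL(2, ℤ)) = parabolicAt Q0 w
    rw [hE, parabolicAt_def]
  -- reindex the `j`-sum along the cycle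
  have hreindex : ∑ j : ZMod r, u (heckePermElt hr PiL (idx (some j))) 0 =
      ∑ k ∈ Finset.range r, u (heckePermElt hr PiL (idx (some (jj k)))) 0 := by
    symm
    refine Finset.sum_nbij (fun k ↦ jj k) (fun _ _ ↦ Finset.mem_univ _) ?_ ?_ (fun _ _ ↦ rfl)
    · intro k₁ hk₁ k₂ hk₂ h
      have h' : (k₁ : ZMod r) = (k₂ : ZMod r) := mul_right_cancel₀ hw0 h
      rw [ZMod.natCast_eq_natCast_iff'] at h'
      rw [Finset.coe_range, Set.mem_Iio] at hk₁ hk₂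
      rwa [Nat.mod_eq_of_lt hk₁, Nat.mod_eq_of_lt hk₂] at h'
    · intro j _
      refine ⟨(j * (w : ZMod r)⁻¹).val, ?_, ?_⟩
      · rw [Finset.coe_range, Set.mem_Iio]
        exact ZMod.val_lt _
      · show (((j * (w : ZMod r)⁻¹).val : ℕ) : ZMod r) * (w : ZMod r) = j
        rw [ZMod.natCast_zmod_val, inv_mul_cancel_right₀ hw0]
  refine ⟨(parabolicAt_cuspMatrix_mem_iff L w P _ hPx).mpr hmemP, (parabolicAt_cuspMatrix_mem_iff L w Q0 _ hQx).mpr hmemQ,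
    ?_⟩
  rw [hsum, Fintype.sum_option, hval0, hreindex, ← huE, hvalQ]

/-- **`parabolicValue` intertwines `T_r` on cocycles with `T♯_r = r A_r + B_r` on cusp functions** (`r` prime, `r ∤ L`,
`r ∤ w`): `parabolicValue w (T_r u) = r · (parabolicValue w u) ∘ ρ_r + (parabolicValue w u) ∘ ρ_r⁻¹`.
[cite: Shimura1971, §8.3 (8.3.2)] -/
theorem parabolicValue_heckeU (hrL : ¬ r ∣ L) (w : ℤ) (hrw : ¬ (r : ℤ) ∣ w) {u : Gamma0 L → Fin 1 → K}
    (hu : u ∈ cocycles 0 L K) :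
    parabolicValue L K w (heckeU 0 L K hr u) =
      ((r : K) • LinearMap.funLeft K K (heckeNbrInfty hr) + LinearMap.funLeft K K (heckeNbrZero hr))
        (parabolicValue L K w u) := by
  funext x
  rw [LinearMap.add_apply, LinearMap.smul_apply, Pi.add_apply, Pi.smul_apply, LinearMap.funLeft_apply,
    LinearMap.funLeft_apply, smul_eq_mul]
  by_cases hx : parabolicAt (cuspMatrix x) w ∈ Gamma0 L
  · rw [parabolicValue_apply_of_mem L K w _ x hx]
    exact (heckeU_parabolicAt L hr hrL w hrw hu x hx).2.2
  · rw [parabolicValue_apply_of_not_mem L K w _ x hx]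
    -- membership travels along `ρ_r^{±1}`, so both values on the right vanish too
    have h1 : parabolicAt (cuspMatrix (heckeNbrInfty hr x)) w ∉ Gamma0 L := by
      intro h
      have h' := (heckeU_parabolicAt L hr hrL w hrw hu _ h).2.1
      exact hx ((parabolicAt_cuspMatrix_mem_iff_of_sameOrbit L w
        (sameOrbit_heckeNbrZero_heckeNbrInfty hr L hrL x)).mp h')
    have h2 : parabolicAt (cuspMatrix (heckeNbrZero hr x)) w ∉ Gamma0 L := by
      intro h
      have h' := (heckeU_parabolicAt L hr hrL w hrw hu _ h).1
      exact hx ((parabolicAt_cuspMatrix_mem_iff_of_sameOrbit L w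
        (sameOrbit_heckeNbrInfty_heckeNbrZero hr L hrL x)).mp h')
    rw [parabolicValue_apply_of_not_mem L K w u _ h1, parabolicValue_apply_of_not_mem L K w u _ h2, mul_zero, add_zero]

end HeckeValue

end Summit.BirchSwinnertonDyer.BirchSwinnertonDyer.Theorems.ManinLocalTwoThree
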